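import Summits.HubbardSuperconductivity.HubbardSuperconductivity.Theorems.KLProgrammeKLRegimeFlowReadScaleZeroSunsetFarSupEntry
import Summits.HubbardSuperconductivity.HubbardSuperconductivity.Theorems.KLProgrammeKLRegimeFlowReadScaleZeroSunsetFarRowsFarSup

/-!
# Route `KLProgramme`, crux K3 — engine-flow child (stmt-HubbardSuperconductivity-20437), stub (C) at `n = 0`, located item #22a «(C)-SCALE0-PT2»,
# THE CERTIFIED SUNSET ROWS WITH THE FAR MIDDLE PROPAGATOR BOOKED BY THE FAR-SUP CERTIFICATE (closer twins of `…TwoShellsSup` / `…PlancherelGaps` / `…TailKlEng`)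

Cell gate-hubbard-kl, seat p1 g22 (k3c5-p1 g15's ask, KL STATUS 2026-08-28 18:56Z, finding «ZONE-II-MAJORANT-DEAD»: near disk `Rc = 1024`, the far-row middle
propagator booked by a TRUE sup `Sfar ≈ 3.5·10⁻⁵` from `ScaleZeroFarSupCert` instead of `S_far = 50e^{−κ₁(Rc+1)} + ω₁(√G₀ + 10⁻¹⁰) ≈ 0.04`).  Three twins, the
frequency-wise far-sup family replaced by ONE entry bound `Sf`:
* §1 **`sunsetRows_of_certV3_twoShells_farSup`** — `…TwoShellsSup.sunsetRows_of_certV3_twoShellsSup` with `hA2 : ‖A((p₀,σ,+),((j₁,x),σ,−))‖ ≤ Sf` at every far `x`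
  in place of the two-shells sup family (so `hR′ : √(16+ω₁²) ≤ (Rc+1)ω₁` drops out) and `hbS : row k + Sf·(high_k + ω₁·Dlow k) ≤ bS k`
  (far rows by `…SunsetFarRowsFarSup.farRows_le_of_farSup`);
* §2 **`sunsetRows_of_certV3_plancherelGaps_farSup`** — the Parseval-gaps layer (`Dlow k := (√G_k + 10⁻¹⁰)²`, `G₁ := √(G₀G₂)`) over §1, `hρ` from `2¹⁰ ≤ L`;
* §3 **`sunsetRows_of_certV3_farSup`** — `…TailKlEng.sunsetRows_of_certV3_klEng` with the far-sup certificate: extra inputs `(r : SunsetFarSupRecord)`,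
  `(hr : ScaleZeroFarSupCert c.toSunsetCellRecordV2 r)`, `(hSfar : 0 ≤ r.Sfar)`; `hA2` discharged by `…SunsetFarSupEntry.norm_gridCov_far_le_of_farSupCert` with
  `Sf := Sfar + 10⁻²⁹`; the budget row reads `row k + (Sfar + 10⁻²⁹)·(2ᵏ·2500·C(ω₁,Rc)/ω₁ + ω₁·(√G_k + 10⁻¹⁰)²) ≤ bS k`; `128 ≤ c.Rc` is no longer needed.

No definitions; nothing here asserts (C), any stub of 20437, K3 or superconductivity; the certificates are named hypotheses.
References: BGM 2006 §2.3 (2.17)–(2.20), §3 (3.2) [cite: BenfattoGiulianiMastropietro2006].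
-/

noncomputable section

namespace Summit.HubbardSuperconductivity.HubbardSuperconductivity.Theorems.KLRegimeSplit

set_option linter.dupNamespace false -- summit = problem name (single-conjunct summit), D-0017

open Literature.MathematicalPhysics.QuantumLattice Literature.Probability.LatticeModels Literature.Analysis.FunctionSpaces
open Summit.HubbardSuperconductivity.HubbardSuperconductivity.Theorems.DispersionFlow
open Summit.HubbardSuperconductivity.HubbardSuperconductivity.Theorems.EngineV8
open MeasureTheory Set Finset Complex UnitAddTorus Real GrassmannAlgebra Matrix
open scoped FourierTransform Nat ENNReal NNReal

variable {L M : ℕ} [NeZero L]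

/-! ## §1 Two-shells form, the far middle propagator by an external sup -/

/-- **THE CERTIFIED SUNSET ROWS — TWO-SHELLS FORM, EXTERNAL FAR SUP** (twin of `sunsetRows_of_certV3_twoShellsSup`). [cite: BenfattoGiulianiMastropietro2006, §2.3 (2.17)-(2.20)] -/
theorem sunsetRows_of_certV3_twoShells_farSup [NeZero M] (c : SunsetCellRecordV3) (hc : ScaleZeroSunsetCertV3 c)
    {μ β : ℝ} (hμlo : (c.μlo : ℝ) ≤ μ) (hμhi : μ ≤ c.μhi)
    (hβ : klBetaMin ≤ β) (hδ : β / ((2 * (2 * M) : ℕ) : ℝ) ≤ (2 : ℝ)⁻¹ ^ 10)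
    {N' R : ℕ} (hN' : 2 * 2 ≤ N') (hR : R + 1 + 2 * c.Rc ≤ L)
    (hT : ENNReal.ofReal (β / klBetaMin) *
        ENNReal.ofReal ((19 / 3) * (4 + |μ| + (0 : TrigPolyC4v).coeffNorm 0) * β / (2 * π ^ 2 * M) +
            (N' ! * klChi2CauchyTab N' * (N' + 1) ! * 4 * (max 1 (4 / klE0)) ^ (N' - 1) * ((2 * π) * 4) ^ N') * (2 / klE0) *
              (1 / (2 * Real.pi) ^ N' * (2 / ((2 * R + 2 : ℕ) : ℝ)) ^ (N' - 2 * 2) * (2 ^ 2 * ∑' k : Site 2, ∏ j, (1 + (k j : ℝ) ^ 2)⁻¹))) ≤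
      ENNReal.ofReal (c.Tmax : ℝ))
    (hrow : ∀ k : Fin 3, 0 ≤ (c.row k : ℝ))
    {ω₁ : ℝ} (hω₁ : klE0 ≤ ω₁) (hρ : Real.exp (-(Real.arsinh (ω₁ / 4) * L / 2)) ≤ 1 / 2)
    {Dlow : Fin 3 → ℝ} (hDlow : ∀ k : Fin 3, 0 ≤ Dlow k)
    (hlow : ∀ (k : Fin 3) (i : MatsubaraIdx M), |matsubaraFreq β M i| < ω₁ →
      ∑ u : TorusSite 2 L,
        (if u ≠ 0 ∧ (fun j => (u j).valMinAbs : Site 2) ∉ c.disk then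
          Real.sqrt ((((u 0).valMinAbs.natAbs : ℝ)) ^ 2 + (((u 1).valMinAbs.natAbs : ℝ)) ^ 2) ^ (k : ℕ) *
            ‖torusFourierInv (fun kv : TorusSite 2 L =>
              (fun y : Momentum => uvSymbolFn 1 klE0 (frameLevel μ 0 ((2 * π) • y)) (matsubaraFreq β M i))
                (WithLp.toLp 2 fun j => ((kv j).val : ℝ) / L)) u‖ ^ 2
          else 0) ≤ Dlow k)
    {Sf : ℝ} (hSf0 : 0 ≤ Sf)
    (hA2 : ∀ (σ : Fin 2) (p₀ : GridPoint L (2 * (2 * M))) (x : TorusSite 2 L),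
      (x ≠ p₀.2 ∧ (fun j => ((x - p₀.2) j).valMinAbs : Site 2) ∉ c.disk) → ∀ j₁ : Fin (2 * (2 * M)),
        ‖((hubbardGridSub L M β (2 * (2 * M))).transpose * hubbardCovAboveCT L M β μ 0 0 klE0 * hubbardGridSub L M β (2 * (2 * M)))
            (((p₀, σ), 0) : GridLeg (GridPoint L (2 * (2 * M)))) ((((j₁, x) : GridPoint L (2 * (2 * M))), σ), 1)‖ ≤ Sf)
    {bS : ℕ → ℝ}
    (hbS : ∀ k : Fin 3, (c.row k : ℝ) + Sf * (2 ^ (k : ℕ) * 2500 *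
        ((max 1 ((2 * (k : ℕ) : ℝ) / Real.arsinh (ω₁ / 4))) ^ (k : ℕ) * Real.exp (-(Real.arsinh (ω₁ / 4) * (c.Rc + 1))) *
          (1 + 2 * (1 - Real.exp (-(Real.arsinh (ω₁ / 4) / 4)))⁻¹) ^ 2) / ω₁ + ω₁ * Dlow k) ≤ bS k) :
    (∀ (σ : Fin 2) (p₀ : GridPoint L (2 * (2 * M))), ∑ p₁ : GridPoint L (2 * (2 * M)),
      (if p₁ = p₀ then (0 : ℝ) else (if p₁.2 - p₀.2 = 0 then (0 : ℝ) else 1) * ‖contr ℂ ((hubbardGridSub L M β (2 * (2 * M))).transpose * hubbardCovAboveCT L M β μ 0 0 klE0 *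
                hubbardGridSub L M β (2 * (2 * M))) (((p₁, σ), 0) : GridLeg (GridPoint L (2 * (2 * M)))) ((p₀, σ), 1) *
              (contr ℂ ((hubbardGridSub L M β (2 * (2 * M))).transpose * hubbardCovAboveCT L M β μ 0 0 klE0 *
                hubbardGridSub L M β (2 * (2 * M))) (((p₀, σ.rev), 0) : GridLeg (GridPoint L (2 * (2 * M)))) ((p₁, σ.rev), 1) *
                contr ℂ ((hubbardGridSub L M β (2 * (2 * M))).transpose * hubbardCovAboveCT L M β μ 0 0 klE0 *
                hubbardGridSub L M β (2 * (2 * M))) (((p₁, σ.rev), 0) : GridLeg (GridPoint L (2 * (2 * M)))) ((p₀, σ.rev), 1))‖) ≤ bS 0 * (((2 * (2 * M) : ℕ) : ℝ) / β)) ∧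
    (∀ k, 1 ≤ k → k ≤ 2 → ∀ (σ : Fin 2) (p₀ : GridPoint L (2 * (2 * M))), ∑ p₁ : GridPoint L (2 * (2 * M)),
      (if p₁ = p₀ then (0 : ℝ) else
        Real.sqrt ((((p₁.2 - p₀.2) 0).valMinAbs.natAbs : ℝ) ^ 2 + (((p₁.2 - p₀.2) 1).valMinAbs.natAbs : ℝ) ^ 2) ^ k * ‖contr ℂ ((hubbardGridSub L M β (2 * (2 * M))).transpose * hubbardCovAboveCT L M β μ 0 0 klE0 *
                hubbardGridSub L M β (2 * (2 * M))) (((p₁, σ), 0) : GridLeg (GridPoint L (2 * (2 * M)))) ((p₀, σ), 1) *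
              (contr ℂ ((hubbardGridSub L M β (2 * (2 * M))).transpose * hubbardCovAboveCT L M β μ 0 0 klE0 *
                hubbardGridSub L M β (2 * (2 * M))) (((p₀, σ.rev), 0) : GridLeg (GridPoint L (2 * (2 * M)))) ((p₁, σ.rev), 1) *
                contr ℂ ((hubbardGridSub L M β (2 * (2 * M))).transpose * hubbardCovAboveCT L M β μ 0 0 klE0 *
                hubbardGridSub L M β (2 * (2 * M))) (((p₁, σ.rev), 0) : GridLeg (GridPoint L (2 * (2 * M)))) ((p₀, σ.rev), 1))‖) ≤
        bS k * (((2 * (2 * M) : ℕ) : ℝ) / β)) := by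
  classical
  have hβ₀ : (0 : ℝ) < klBetaMin := by norm_num [klBetaMin]
  have hβpos : 0 < β := lt_of_lt_of_le hβ₀ hβ
  have hE0 : (0 : ℝ) < klE0 := by norm_num [klE0]
  have hω₁0 : 0 < ω₁ := lt_of_lt_of_le hE0 hω₁
  -- high-shell constant per row
  set Ch : Fin 3 → ℝ := fun k => 2 ^ (k : ℕ) * 2500 *
    ((max 1 ((2 * (k : ℕ) : ℝ) / Real.arsinh (ω₁ / 4))) ^ (k : ℕ) * Real.exp (-(Real.arsinh (ω₁ / 4) * (c.Rc + 1))) *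
      (1 + 2 * (1 - Real.exp (-(Real.arsinh (ω₁ / 4) / 4)))⁻¹) ^ 2) / ω₁ with hCh
  -- the per-frequency family: high shell by the strip, low shell by the envelope
  set farL2 : Fin 3 → MatsubaraIdx M → ℝ := fun k i => ∑ u : TorusSite 2 L,
      (if u ≠ 0 ∧ (fun j => (u j).valMinAbs : Site 2) ∉ c.disk then
        Real.sqrt ((((u 0).valMinAbs.natAbs : ℝ)) ^ 2 + (((u 1).valMinAbs.natAbs : ℝ)) ^ 2) ^ (k : ℕ) *
          ‖torusFourierInv (fun kv : TorusSite 2 L =>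
            (fun y : Momentum => uvSymbolFn 1 klE0 (frameLevel μ 0 ((2 * π) • y)) (matsubaraFreq β M i))
              (WithLp.toLp 2 fun j => ((kv j).val : ℝ) / L)) u‖ ^ 2
        else 0) with hfarL2
  have hsplit : ∀ (k : Fin 3) (i : MatsubaraIdx M), farL2 k i ≤
      (if ω₁ ≤ |matsubaraFreq β M i| then farL2 k i else 0) + (if |matsubaraFreq β M i| < ω₁ then Dlow k else 0) := by
    intro k i
    by_cases h : ω₁ ≤ |matsubaraFreq β M i|
    · rw [if_pos h, if_neg (not_lt.2 h), add_zero]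
    · rw [if_neg h, if_pos (not_le.1 h), zero_add]
      exact hlow k i (not_le.1 h)
  -- the window sum of the family
  have hΦsum : ∀ k : Fin 3, (1 / β) * ∑ i : MatsubaraIdx M, farL2 k i ≤ Ch k + ω₁ * Dlow k := by
    intro k
    have hhigh := sum_l2Far_high_le (L := L) c.toSunsetCellRecordV2 μ hβpos hω₁ hρ M k
    have hlow' := sum_l2Far_low_le hβpos hω₁0 (hDlow k) M
    have h1 : ∑ i : MatsubaraIdx M, farL2 k i ≤ β * Ch k + β * ω₁ * Dlow k := by
      refine (Finset.sum_le_sum fun i _ => hsplit k i).trans ?_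
      rw [Finset.sum_add_distrib]
      refine add_le_add (le_trans (le_of_eq rfl) (hhigh.trans (le_of_eq ?_))) hlow'
      simp only [hCh]
    rw [one_div, inv_mul_le_iff₀ hβpos]
    linarith
  -- the far rows through the interface
  -- the far rows through the external sup
  have hfar : ∀ (k : Fin 3) (σ : Fin 2) (p₀ : GridPoint L (2 * (2 * M))), _ :=
    fun k σ p₀ => farRows_le_of_farSup (L := L) (M := M) c.toSunsetCellRecordV2 hβpos k (Φ := farL2 k) (fun i => le_rfl) σ p₀ hSf0 (hA2 σ.rev p₀)
  refine sunsetRows_of_certV3 c hc hμlo hμhi hβ hδ hN' hR hT hrow (bFar := fun k => Sf * (if hk : k < 3 then Ch ⟨k, hk⟩ + ω₁ * Dlow ⟨k, hk⟩ else 0))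
    (fun k σ p₀ => ?_) (fun k => ?_)
  · -- far row k ≤ S·(Ch + ω₁ Dlow)·(4M/β)
    have h := hfar k σ p₀
    refine h.trans ?_
    have hk : (k : ℕ) < 3 := k.isLt
    have hN : 0 ≤ (((2 * (2 * M) : ℕ) : ℝ) / β) := by positivity
    have hΦ0 : 0 ≤ (1 / β) * ∑ i : MatsubaraIdx M, farL2 k i := by
      refine mul_nonneg (by positivity) (Finset.sum_nonneg fun i _ => Finset.sum_nonneg fun u _ => ?_)
      split_ifs <;> positivity
    have hkey : Sf * ((1 / β) * ∑ i : MatsubaraIdx M, farL2 k i) ≤ Sf * (if hk' : (k : ℕ) < 3 then Ch ⟨k, hk'⟩ + ω₁ * Dlow ⟨k, hk'⟩ else 0) := by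
      rw [dif_pos hk]
      exact mul_le_mul_of_nonneg_left (hΦsum k) hSf0
    exact mul_le_mul_of_nonneg_right hkey hN
  · have hk : (k : ℕ) < 3 := k.isLt
    simp only [hk, dif_pos]
    exact hbS k

/-! ## §2 The Parseval-gaps layer -/

/-- **THE CERTIFIED SUNSET ROWS FROM THE NEAR CERTIFICATE, THE TWO FAR PARSEVAL GAPS AND AN EXTERNAL FAR SUP** (twin of `sunsetRows_of_certV3_plancherelGaps'`). [cite: BenfattoGiulianiMastropietro2006, §2.3 (2.17)-(2.20)] -/
theorem sunsetRows_of_certV3_plancherelGaps_farSup [NeZero M] (c : SunsetCellRecordV3) (hc : ScaleZeroSunsetCertV3 c)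
    {μ β U : ℝ} (hμlo : (c.μlo : ℝ) ≤ μ) (hμhi : μ ≤ c.μhi)
    (hβ : klBetaMin ≤ β) (hU0 : 0 < U) (hU : U ≤ (2 : ℝ)⁻¹ ^ 20) (hL3 : klEngL₃ β U ≤ L)
    (hδ : β / ((2 * (2 * M) : ℕ) : ℝ) ≤ (2 : ℝ)⁻¹ ^ 10)
    {N' R : ℕ} (hN' : 2 * 2 ≤ N') (hR : R + 1 + 2 * c.Rc ≤ L)
    (hT : ENNReal.ofReal (β / klBetaMin) *
        ENNReal.ofReal ((19 / 3) * (4 + |μ| + (0 : TrigPolyC4v).coeffNorm 0) * β / (2 * π ^ 2 * M) +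
            (N' ! * klChi2CauchyTab N' * (N' + 1) ! * 4 * (max 1 (4 / klE0)) ^ (N' - 1) * ((2 * π) * 4) ^ N') * (2 / klE0) *
              (1 / (2 * Real.pi) ^ N' * (2 / ((2 * R + 2 : ℕ) : ℝ)) ^ (N' - 2 * 2) * (2 ^ 2 * ∑' k : Site 2, ∏ j, (1 + (k j : ℝ) ^ 2)⁻¹))) ≤
      ENNReal.ofReal (c.Tmax : ℝ))
    (hrow : ∀ k : Fin 3, 0 ≤ (c.row k : ℝ))
    {ω₁ : ℝ} (hω₁ : klE0 ≤ ω₁)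
    {G₀ G₂ : ℝ}
    (hgap0 : ∀ i : MatsubaraIdx M, |matsubaraFreq β M i| < ω₁ →
      (∫ y in Torus.unitCube (Fin 2), ‖(fun y : Momentum => uvSymbolFn 1 klE0 (frameLevel μ 0 ((2 * π) • y)) (matsubaraFreq β M i)) y‖ ^ 2) -
        ∑ z ∈ insert (0 : Site 2) c.disk, ‖mFourierCoeff (Torus.descend
          (fun y : Momentum => uvSymbolFn 1 klE0 (frameLevel μ 0 ((2 * π) • y)) (matsubaraFreq β M i))
          (uvSpatialSymbol_isLatticePeriodic 1 klE0 μ 0 (matsubaraFreq β M i))) (-z)‖ ^ 2 ≤ G₀)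
    (hgap2 : ∀ i : MatsubaraIdx M, |matsubaraFreq β M i| < ω₁ →
      (2 * π) ^ (-(2 : ℤ)) *
        ((∫ y in Torus.unitCube (Fin 2), ‖fderiv ℝ (fun y : Momentum => uvSymbolFn 1 klE0 (frameLevel μ 0 ((2 * π) • y)) (matsubaraFreq β M i)) y
            (EuclideanSpace.single 0 (1 : ℝ))‖ ^ 2) +
          ∫ y in Torus.unitCube (Fin 2), ‖fderiv ℝ (fun y : Momentum => uvSymbolFn 1 klE0 (frameLevel μ 0 ((2 * π) • y)) (matsubaraFreq β M i)) y
            (EuclideanSpace.single 1 (1 : ℝ))‖ ^ 2) -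
        ∑ z ∈ insert (0 : Site 2) c.disk, ((((z 0 : ℤ) : ℝ)) ^ 2 + (((z 1 : ℤ) : ℝ)) ^ 2) *
          ‖mFourierCoeff (Torus.descend (fun y : Momentum => uvSymbolFn 1 klE0 (frameLevel μ 0 ((2 * π) • y)) (matsubaraFreq β M i))
            (uvSpatialSymbol_isLatticePeriodic 1 klE0 μ 0 (matsubaraFreq β M i))) (-z)‖ ^ 2 ≤ G₂)
    {Sf : ℝ} (hSf0 : 0 ≤ Sf)
    (hA2 : ∀ (σ : Fin 2) (p₀ : GridPoint L (2 * (2 * M))) (x : TorusSite 2 L),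
      (x ≠ p₀.2 ∧ (fun j => ((x - p₀.2) j).valMinAbs : Site 2) ∉ c.disk) → ∀ j₁ : Fin (2 * (2 * M)),
        ‖((hubbardGridSub L M β (2 * (2 * M))).transpose * hubbardCovAboveCT L M β μ 0 0 klE0 * hubbardGridSub L M β (2 * (2 * M)))
            (((p₀, σ), 0) : GridLeg (GridPoint L (2 * (2 * M)))) ((((j₁, x) : GridPoint L (2 * (2 * M))), σ), 1)‖ ≤ Sf)
    {bS : ℕ → ℝ}
    (hbS : ∀ k : Fin 3, (c.row k : ℝ) +
      Sf *
        (2 ^ (k : ℕ) * 2500 *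
          ((max 1 ((2 * (k : ℕ) : ℝ) / Real.arsinh (ω₁ / 4))) ^ (k : ℕ) * Real.exp (-(Real.arsinh (ω₁ / 4) * (c.Rc + 1))) *
            (1 + 2 * (1 - Real.exp (-(Real.arsinh (ω₁ / 4) / 4)))⁻¹) ^ 2) / ω₁ +
          ω₁ * (Real.sqrt (![G₀, Real.sqrt (G₀ * G₂), G₂] k) + (10 : ℝ)⁻¹ ^ 10) ^ 2) ≤ bS k) :
    (∀ (σ : Fin 2) (p₀ : GridPoint L (2 * (2 * M))), ∑ p₁ : GridPoint L (2 * (2 * M)),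
      (if p₁ = p₀ then (0 : ℝ) else (if p₁.2 - p₀.2 = 0 then (0 : ℝ) else 1) * ‖contr ℂ ((hubbardGridSub L M β (2 * (2 * M))).transpose * hubbardCovAboveCT L M β μ 0 0 klE0 *
                hubbardGridSub L M β (2 * (2 * M))) (((p₁, σ), 0) : GridLeg (GridPoint L (2 * (2 * M)))) ((p₀, σ), 1) *
              (contr ℂ ((hubbardGridSub L M β (2 * (2 * M))).transpose * hubbardCovAboveCT L M β μ 0 0 klE0 *
                hubbardGridSub L M β (2 * (2 * M))) (((p₀, σ.rev), 0) : GridLeg (GridPoint L (2 * (2 * M)))) ((p₁, σ.rev), 1) *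
                contr ℂ ((hubbardGridSub L M β (2 * (2 * M))).transpose * hubbardCovAboveCT L M β μ 0 0 klE0 *
                hubbardGridSub L M β (2 * (2 * M))) (((p₁, σ.rev), 0) : GridLeg (GridPoint L (2 * (2 * M)))) ((p₀, σ.rev), 1))‖) ≤ bS 0 * (((2 * (2 * M) : ℕ) : ℝ) / β)) ∧
    (∀ k, 1 ≤ k → k ≤ 2 → ∀ (σ : Fin 2) (p₀ : GridPoint L (2 * (2 * M))), ∑ p₁ : GridPoint L (2 * (2 * M)),
      (if p₁ = p₀ then (0 : ℝ) else
        Real.sqrt ((((p₁.2 - p₀.2) 0).valMinAbs.natAbs : ℝ) ^ 2 + (((p₁.2 - p₀.2) 1).valMinAbs.natAbs : ℝ) ^ 2) ^ k * ‖contr ℂ ((hubbardGridSub L M β (2 * (2 * M))).transpose * hubbardCovAboveCT L M β μ 0 0 klE0 *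
                hubbardGridSub L M β (2 * (2 * M))) (((p₁, σ), 0) : GridLeg (GridPoint L (2 * (2 * M)))) ((p₀, σ), 1) *
              (contr ℂ ((hubbardGridSub L M β (2 * (2 * M))).transpose * hubbardCovAboveCT L M β μ 0 0 klE0 *
                hubbardGridSub L M β (2 * (2 * M))) (((p₀, σ.rev), 0) : GridLeg (GridPoint L (2 * (2 * M)))) ((p₁, σ.rev), 1) *
                contr ℂ ((hubbardGridSub L M β (2 * (2 * M))).transpose * hubbardCovAboveCT L M β μ 0 0 klE0 *
                hubbardGridSub L M β (2 * (2 * M))) (((p₁, σ.rev), 0) : GridLeg (GridPoint L (2 * (2 * M)))) ((p₀, σ.rev), 1))‖) ≤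
        bS k * (((2 * (2 * M) : ℕ) : ℝ) / β)) := by
  have hβ₀ : (0 : ℝ) < klBetaMin := by norm_num [klBetaMin]
  have hβpos : 0 < β := lt_of_lt_of_le hβ₀ hβ
  -- `hρ` from `2¹⁰ ≤ L`
  have h210 : 2 ^ 10 ≤ L := by
    refine le_trans ?_ hL3
    unfold klEngL₃
    have h1 : 1 ≤ (⌈|β|⌉₊ + 1) ^ 2 := Nat.one_le_pow _ _ (Nat.succ_pos _)
    have h2 : 1 ≤ (⌈|U|⁻¹⌉₊ + 1) ^ 2 := Nat.one_le_pow _ _ (Nat.succ_pos _)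
    calc 2 ^ 10 = 2 ^ 10 * 1 * 1 := by norm_num
      _ ≤ 2 ^ 10 * (⌈|β|⌉₊ + 1) ^ 2 * (⌈|U|⁻¹⌉₊ + 1) ^ 2 := Nat.mul_le_mul (Nat.mul_le_mul_left _ h1) h2
  have hρ := exp_neg_arsinh_mul_le_half_of_le (L := L) hω₁ h210
  -- the three far lattice sums from the two gaps
  set D : Fin 3 → ℝ := ![G₀, Real.sqrt (G₀ * G₂), G₂] with hDdef
  have hD : ∀ (k : Fin 3) (i : MatsubaraIdx M), |matsubaraFreq β M i| < ω₁ →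
      ∑' z : Site 2, (if z ≠ 0 ∧ z ∉ c.disk then Real.sqrt ((((z 0 : ℤ) : ℝ)) ^ 2 + (((z 1 : ℤ) : ℝ)) ^ 2) ^ (k : ℕ) else 0) *
        ‖mFourierCoeff (Torus.descend (fun y : Momentum => uvSymbolFn 1 klE0 (frameLevel μ 0 ((2 * π) • y)) (matsubaraFreq β M i))
          (uvSpatialSymbol_isLatticePeriodic 1 klE0 μ 0 (matsubaraFreq β M i))) (-z)‖ ^ 2 ≤ D k := by
    intro k i hi
    have hne : matsubaraFreq β M i ≠ 0 := matsubaraFreq_ne_zero' hβpos i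
    fin_cases k
    · exact farLattice_bare_zero_le_of_gap μ c.toSunsetCellRecordV2 hne (hgap0 i hi)
    · exact farLattice_bare_one_le_of_gaps μ c.toSunsetCellRecordV2 hne (hgap0 i hi) (hgap2 i hi)
    · exact farLattice_bare_two_le_of_gap μ c.toSunsetCellRecordV2 hne (hgap2 i hi)
  -- the low-shell envelope under the engine thresholds
  have hlow := l2Far_low_envelope_of_farLattice_klEng (L := L) μ hβ hU0 hU hL3 ω₁ c.toSunsetCellRecordV2 hD
  exact sunsetRows_of_certV3_twoShells_farSup (L := L) c hc hμlo hμhi hβ hδ hN' hR hT hrow hω₁ hρ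
    (Dlow := fun k => (Real.sqrt (D k) + (10 : ℝ)⁻¹ ^ 10) ^ 2) (fun k => sq_nonneg _) hlow hSf0 hA2 hbS

/-! ## §3 At the engine thresholds, the far sup from `ScaleZeroFarSupCert` -/

/-- **THE CERTIFIED SUNSET ROWS AT THE ENGINE THRESHOLDS WITH THE FAR-SUP CERTIFICATE** (twin of `sunsetRows_of_certV3_klEng`; `Sf := Sfar + 10⁻²⁹`). [cite: BenfattoGiulianiMastropietro2006, §2.3 (2.17)-(2.20)] -/
theorem sunsetRows_of_certV3_farSup [NeZero M] (c : SunsetCellRecordV3) (hc : ScaleZeroSunsetCertV3 c)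
    {μ β U : ℝ} (hμ : μ ∈ klWindowC) (hμlo : (c.μlo : ℝ) ≤ μ) (hμhi : μ ≤ c.μhi)
    (hβ : klBetaMin ≤ β) (hU0 : 0 < U) (hU : U ≤ (2 : ℝ)⁻¹ ^ 20) (hL3 : klEngL₃ β U ≤ L) (hM3 : klEngM₃ β U L ≤ M)
    (hRcL : 4 * c.Rc + 2 ≤ L) (hTmax : (10 : ℝ)⁻¹ ^ 30 ≤ (c.Tmax : ℝ))
    (hrow : ∀ k : Fin 3, 0 ≤ (c.row k : ℝ))
    {ω₁ : ℝ} (hω₁ : klE0 ≤ ω₁)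
    (r : SunsetFarSupRecord) (hr : ScaleZeroFarSupCert c.toSunsetCellRecordV2 r) (hSfar : 0 ≤ (r.Sfar : ℝ))
    {G₀ G₂ : ℝ}
    (hgap0 : ∀ i : MatsubaraIdx M, |matsubaraFreq β M i| < ω₁ →
      (∫ y in Torus.unitCube (Fin 2), ‖(fun y : Momentum => uvSymbolFn 1 klE0 (frameLevel μ 0 ((2 * π) • y)) (matsubaraFreq β M i)) y‖ ^ 2) -
        ∑ z ∈ insert (0 : Site 2) c.disk, ‖mFourierCoeff (Torus.descend
          (fun y : Momentum => uvSymbolFn 1 klE0 (frameLevel μ 0 ((2 * π) • y)) (matsubaraFreq β M i))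
          (uvSpatialSymbol_isLatticePeriodic 1 klE0 μ 0 (matsubaraFreq β M i))) (-z)‖ ^ 2 ≤ G₀)
    (hgap2 : ∀ i : MatsubaraIdx M, |matsubaraFreq β M i| < ω₁ →
      (2 * π) ^ (-(2 : ℤ)) *
        ((∫ y in Torus.unitCube (Fin 2), ‖fderiv ℝ (fun y : Momentum => uvSymbolFn 1 klE0 (frameLevel μ 0 ((2 * π) • y)) (matsubaraFreq β M i)) y
            (EuclideanSpace.single 0 (1 : ℝ))‖ ^ 2) +
          ∫ y in Torus.unitCube (Fin 2), ‖fderiv ℝ (fun y : Momentum => uvSymbolFn 1 klE0 (frameLevel μ 0 ((2 * π) • y)) (matsubaraFreq β M i)) y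
            (EuclideanSpace.single 1 (1 : ℝ))‖ ^ 2) -
        ∑ z ∈ insert (0 : Site 2) c.disk, ((((z 0 : ℤ) : ℝ)) ^ 2 + (((z 1 : ℤ) : ℝ)) ^ 2) *
          ‖mFourierCoeff (Torus.descend (fun y : Momentum => uvSymbolFn 1 klE0 (frameLevel μ 0 ((2 * π) • y)) (matsubaraFreq β M i))
            (uvSpatialSymbol_isLatticePeriodic 1 klE0 μ 0 (matsubaraFreq β M i))) (-z)‖ ^ 2 ≤ G₂)
    {bS : ℕ → ℝ}
    (hbS : ∀ k : Fin 3, (c.row k : ℝ) +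
      ((r.Sfar : ℝ) + (10 : ℝ)⁻¹ ^ 29) *
        (2 ^ (k : ℕ) * 2500 *
          ((max 1 ((2 * (k : ℕ) : ℝ) / Real.arsinh (ω₁ / 4))) ^ (k : ℕ) * Real.exp (-(Real.arsinh (ω₁ / 4) * (c.Rc + 1))) *
            (1 + 2 * (1 - Real.exp (-(Real.arsinh (ω₁ / 4) / 4)))⁻¹) ^ 2) / ω₁ +
          ω₁ * (Real.sqrt (![G₀, Real.sqrt (G₀ * G₂), G₂] k) + (10 : ℝ)⁻¹ ^ 10) ^ 2) ≤ bS k) :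
    (∀ (σ : Fin 2) (p₀ : GridPoint L (2 * (2 * M))), ∑ p₁ : GridPoint L (2 * (2 * M)),
      (if p₁ = p₀ then (0 : ℝ) else (if p₁.2 - p₀.2 = 0 then (0 : ℝ) else 1) * ‖contr ℂ ((hubbardGridSub L M β (2 * (2 * M))).transpose * hubbardCovAboveCT L M β μ 0 0 klE0 *
                hubbardGridSub L M β (2 * (2 * M))) (((p₁, σ), 0) : GridLeg (GridPoint L (2 * (2 * M)))) ((p₀, σ), 1) *
              (contr ℂ ((hubbardGridSub L M β (2 * (2 * M))).transpose * hubbardCovAboveCT L M β μ 0 0 klE0 *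
                hubbardGridSub L M β (2 * (2 * M))) (((p₀, σ.rev), 0) : GridLeg (GridPoint L (2 * (2 * M)))) ((p₁, σ.rev), 1) *
                contr ℂ ((hubbardGridSub L M β (2 * (2 * M))).transpose * hubbardCovAboveCT L M β μ 0 0 klE0 *
                hubbardGridSub L M β (2 * (2 * M))) (((p₁, σ.rev), 0) : GridLeg (GridPoint L (2 * (2 * M)))) ((p₀, σ.rev), 1))‖) ≤ bS 0 * (((2 * (2 * M) : ℕ) : ℝ) / β)) ∧
    (∀ k, 1 ≤ k → k ≤ 2 → ∀ (σ : Fin 2) (p₀ : GridPoint L (2 * (2 * M))), ∑ p₁ : GridPoint L (2 * (2 * M)),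
      (if p₁ = p₀ then (0 : ℝ) else
        Real.sqrt ((((p₁.2 - p₀.2) 0).valMinAbs.natAbs : ℝ) ^ 2 + (((p₁.2 - p₀.2) 1).valMinAbs.natAbs : ℝ) ^ 2) ^ k * ‖contr ℂ ((hubbardGridSub L M β (2 * (2 * M))).transpose * hubbardCovAboveCT L M β μ 0 0 klE0 *
                hubbardGridSub L M β (2 * (2 * M))) (((p₁, σ), 0) : GridLeg (GridPoint L (2 * (2 * M)))) ((p₀, σ), 1) *
              (contr ℂ ((hubbardGridSub L M β (2 * (2 * M))).transpose * hubbardCovAboveCT L M β μ 0 0 klE0 *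
                hubbardGridSub L M β (2 * (2 * M))) (((p₀, σ.rev), 0) : GridLeg (GridPoint L (2 * (2 * M)))) ((p₁, σ.rev), 1) *
                contr ℂ ((hubbardGridSub L M β (2 * (2 * M))).transpose * hubbardCovAboveCT L M β μ 0 0 klE0 *
                hubbardGridSub L M β (2 * (2 * M))) (((p₁, σ.rev), 0) : GridLeg (GridPoint L (2 * (2 * M)))) ((p₀, σ.rev), 1))‖) ≤
        bS k * (((2 * (2 * M) : ℕ) : ℝ) / β)) := by
  have hβ₀ : klBetaMin = 128 := rfl
  have hβ128 : (128 : ℝ) ≤ β := by rw [← hβ₀]; exact hβ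
  have hβpos : 0 < β := by linarith
  have hLpos : (0 : ℝ) < L := by
    have h := (klEngL₃_ge_of_le hβ hU0 hU).trans hL3
    have h' : 0 < L := lt_of_lt_of_le (by norm_num) h
    exact_mod_cast h'
  -- `β/4M ≤ 2⁻¹⁰` from `M ≥ klEngM₃ ≥ 2¹⁰β²L² ≥ 2¹⁰·β`
  have hδ : β / ((2 * (2 * M) : ℕ) : ℝ) ≤ (2 : ℝ)⁻¹ ^ 10 := by
    have hM' : ((klEngM₃ β U L : ℕ) : ℝ) ≤ M := by exact_mod_cast hM3
    have hMge : (2 : ℝ) ^ 10 * β ≤ M := by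
      refine le_trans ?_ hM'
      unfold klEngM₃
      push_cast
      have hceil : β ≤ (⌈|β|⌉₊ : ℝ) := by rw [abs_of_pos hβpos]; exact Nat.le_ceil β
      have h1 : β ≤ ((⌈|β|⌉₊ : ℝ) + 1) ^ 2 := by nlinarith
      have h2 : (1 : ℝ) ≤ ((L : ℝ) + 1) ^ 2 := by nlinarith
      calc (2 : ℝ) ^ 10 * β = 2 ^ 10 * β * 1 := by ring
        _ ≤ 2 ^ 10 * ((⌈|β|⌉₊ : ℝ) + 1) ^ 2 * ((L : ℝ) + 1) ^ 2 := mul_le_mul (mul_le_mul_of_nonneg_left h1 (by positivity)) h2 (by positivity) (by positivity)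
        _ = _ := by norm_num
    have hMpos : (0 : ℝ) < M := lt_of_lt_of_le (by positivity) hMge
    have hN : ((2 * (2 * M) : ℕ) : ℝ) = 4 * M := by push_cast; ring
    rw [hN, div_le_iff₀ (by positivity)]
    nlinarith
  obtain ⟨hR, -⟩ := sunsetTail_R_of_le hRcL
  have hT := sunsetTail_hT_of_klEng (L := L) (M := M) (Rc := c.Rc) hμ hβ hU0 hU hL3 hM3 hRcL hTmax
  have hS0 : 0 ≤ (r.Sfar : ℝ) + (10 : ℝ)⁻¹ ^ 29 := by positivity
  have hA2 : ∀ (σ : Fin 2) (p₀ : GridPoint L (2 * (2 * M))) (x : TorusSite 2 L),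
      (x ≠ p₀.2 ∧ (fun j => ((x - p₀.2) j).valMinAbs : Site 2) ∉ c.disk) → ∀ j₁ : Fin (2 * (2 * M)),
        ‖((hubbardGridSub L M β (2 * (2 * M))).transpose * hubbardCovAboveCT L M β μ 0 0 klE0 * hubbardGridSub L M β (2 * (2 * M)))
            (((p₀, σ), 0) : GridLeg (GridPoint L (2 * (2 * M)))) ((((j₁, x) : GridPoint L (2 * (2 * M))), σ), 1)‖ ≤ (r.Sfar : ℝ) + (10 : ℝ)⁻¹ ^ 29 :=
    fun σ p₀ x hx j₁ => norm_gridCov_far_le_of_farSupCert (L := L) (M := M) c.toSunsetCellRecordV2 r hr hSfar hμlo hμhi hμ hβ hU0 hU hL3 hM3 σ p₀ x hx j₁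
  exact sunsetRows_of_certV3_plancherelGaps_farSup (L := L) c hc hμlo hμhi hβ hU0 hU hL3 hδ (N' := 12) (R := L - 1 - 2 * c.Rc) (by norm_num) hR hT hrow hω₁
    hgap0 hgap2 hS0 hA2 hbS

end Summit.HubbardSuperconductivity.HubbardSuperconductivity.Theorems.KLRegimeSplit

end
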